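import Summits.Langlands.Langlands.Theorems.IrreducibilityBySelfDualityHeckeEigenvalueFieldStubConeGrowthEval
import HarnessLib

/-!
# Crux `HeckeEigenvalueField` (stmt-Langlands-13632), line `Sketch`, stub GROWTH-ω — part 3:
# growth of the left form and of its derivative; smoothness of pull-backs

Helper file (part 3 of 5) for the registered stub `stub_coneForm_growth`.  Theorems only.

1. **Order-0 and order-1 growth of the left form `m ↦ (Y ↦ E(m) η(Y)(m, c))`** at the invertible
   matrices (`cfg_norm_leftFormN_growth`, `cfg_norm_fderiv_leftFormN_growth`): on vectors the form is the
   twisted evaluation of the multilinear `Y ↦ η(Y)`, and its derivative along `g b_k` is the twisted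
   evaluation of `b_k · η(Y)` (`fderiv_leftForm_apply`; the Leibniz action of a fixed matrix is an
   `ℝ`-linear map of the carrier, `cfg_exists_lieAction`); a direction `Z` is `∑_k c_k(g⁻¹Z) · g b_k`.
2. **Pull-backs of `Cⁿ` families of alternating maps along `Cⁿ` families of linear maps are `Cⁿ`**
   (`cfg_contDiffAt_altCompCLM`), and `‖f ∘' g‖ ≤ (q + 1) ‖g‖^q ‖f‖` for the derivative of the
   pull-back in the linear map (`cfg_norm_fderivCompCLM_le`).

[cite: BorelWallach2000, VII 2.2–2.4]
-/

set_option linter.dupNamespace false -- project-wide: `Summit.Langlands.Langlands` is the mandated namespace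

noncomputable section

open scoped Matrix.Norms.Operator ContDiff Topology TensorProduct Classical Matrix ComplexConjugate
open Filter NumberField NumberField.mixedEmbedding
open Literature.NumberTheory.Automorphic Literature.NumberTheory.Automorphic.RealMatrixGroup
  Literature.NumberTheory.Automorphic.ConeDictionary

-- Same instance context as the c8 file `…ResConeAnalytic` (whose lemmas are used throughout): calculus of
-- FORM-valued maps on `M_n(K_∞)` along ONE topology/uniformity, those of the operator norm
-- `Matrix.Norms.Operator` (the types of `leftFormN`, `fderiv_leftForm_apply`); the product instances are removed.
attribute [-instance] instTopologicalSpaceMatrix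
attribute [-instance] Matrix.instUniformSpace

namespace Summit.Langlands.Langlands.Theorems.HeckeEigenvalueField.Res

/-! ### 5. Growth of the left form and of its derivative at the invertible matrices -/

section LeftForm

variable {n : ℕ} {K : Type} [Field K] [NumberField K] {hcpt : isCompact_glFiniteIntegralLevel n K}
  (π : AutomorphicRepData (AutomorphyDatum.gl n K hcpt))
  (S : Finset {w : InfinitePlace K // w.IsReal}) (lam : (K →+* ℂ) → Fin n → ℤ) {q : ℕ}
  (sz : (AutomorphyDatum.gl n K hcpt).arch.carrier → ℝ)

omit [NumberField K] in
/-- A matrix whose entries are bounded by `s` has operator norm at most `n² s`. [folklore] -/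
theorem cfg_opNorm_le_of_entries [NumberField K] (m : Matrix (Fin n) (Fin n) (mixedSpace K)) {s : ℝ}
    (h : ∀ i j, ‖m i j‖ ≤ s) : ‖m‖ ≤ (n : ℝ) ^ 2 * s := by
  refine (cfg_norm_le_sum_entries m).trans ?_
  calc ∑ i, ∑ j, ‖m i j‖ ≤ ∑ _i : Fin n, ∑ _j : Fin n, s :=
        Finset.sum_le_sum fun i _ => Finset.sum_le_sum fun j _ => h i j
    _ = (n : ℝ) ^ 2 * s := by
        simp only [Finset.sum_const, Finset.card_univ, Fintype.card_fin]
        ring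

omit [NumberField K] in
/-- The same for the conjugate transpose. [folklore] -/
theorem cfg_opNorm_conjTranspose_le_of_entries [NumberField K] (m : Matrix (Fin n) (Fin n) (mixedSpace K))
    {s : ℝ} (h : ∀ i j, ‖m i j‖ ≤ s) : ‖mᴴ‖ ≤ (n : ℝ) ^ 2 * s := by
  refine (cfg_norm_conjTranspose_le_sum_entries m).trans ?_
  calc ∑ i, ∑ j, ‖m i j‖ ≤ ∑ _i : Fin n, ∑ _j : Fin n, s :=
        Finset.sum_le_sum fun i _ => Finset.sum_le_sum fun j _ => h i j
    _ = (n : ℝ) ^ 2 * s := by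
        simp only [Finset.sum_const, Finset.card_univ, Fintype.card_fin]
        ring

/-- **Order-0 growth of the left form** `m ↦ (Y ↦ E(m) η(Y)(m, c))` at the invertible matrices: on
vectors it is the twisted evaluation of the multilinear map `Y ↦ η(Y)`. [cite: BorelWallach2000, VII §2.2] -/
theorem cfg_norm_leftFormN_growth (hsz : ∀ g, 1 ≤ sz g)
    (hE : ∀ (g : (AutomorphyDatum.gl n K hcpt).arch.carrier) i j,
      ‖((g : GL (Fin n) (mixedSpace K)) : Matrix (Fin n) (Fin n) (mixedSpace K)) i j‖ ≤ sz g)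
    (hI : ∀ (g : (AutomorphyDatum.gl n K hcpt).arch.carrier) i j, ‖(((g⁻¹ : (AutomorphyDatum.gl n K hcpt).arch.carrier) : GL (Fin n) (mixedSpace K)) :
      Matrix (Fin n) (Fin n) (mixedSpace K)) i j‖ ≤ sz g)
    (η : ConeDictionary.Cochain π lam (q + 1)) (c : BigHeckeGLn.FiniteAdelicGL n K) :
    ∃ (C : ℝ) (k : ℕ), 0 ≤ C ∧ ∀ g : (AutomorphyDatum.gl n K hcpt).arch.carrier,
      ‖leftFormN π S lam η c ((g : GL (Fin n) (mixedSpace K)) : Matrix (Fin n) (Fin n) (mixedSpace K))‖ ≤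
        C * sz g ^ k := by
  obtain ⟨C, k, hC, h⟩ := cfg_twistedEval_multilinear_growth π S lam sz hsz hE hI c
    (η.toMultilinearMap.compLinearMap fun _ : Fin (q + 1) => toLie n K hcpt)
  refine ⟨C, k, hC, fun g => ContinuousAlternatingMap.opNorm_le_bound _
    (mul_nonneg hC (pow_nonneg (zero_le_one.trans (hsz g)) _)) fun Y => ?_⟩
  have e : leftFormN π S lam η c ((g : GL (Fin n) (mixedSpace K)) : Matrix (Fin n) (Fin n) (mixedSpace K)) Y =
      twistedEval π S lam g c ((η.toMultilinearMap.compLinearMap fun _ : Fin (q + 1) => toLie n K hcpt) Y) := by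
    rw [MultilinearMap.compLinearMap_apply, AlternatingMap.coe_multilinearMap]
    show leftForm π S lam η c _ Y = _
    rw [leftForm_apply, archOfMatrix_coe_datum, leftFormAlg_apply]
  rw [e]
  exact h g Y

/-- **The action of a fixed matrix `X` on the carrier `W ⊗ E_λ`** (Leibniz action of `toLie X`), as an
`ℝ`-linear map of the carrier (whose real structure is the restriction of the complex one, as for
`twistedEval`). [cite: BorelWallach2000, I §5.1] -/
theorem cfg_exists_lieAction (X : Matrix (Fin n) (Fin n) (mixedSpace K)) :
    ∃ ρX : Carrier π lam →ₗ[ℝ] Carrier π lam, ∀ t : Carrier π lam,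
      @id (π.W ⊗[ℂ] ResGLnCohomology.CoeffModule ℂ n K lam) (ρX t) =
        GKTensor.lie (AutomorphyDatum.gl n K hcpt).arch π.lieRepW (σ𝔤S hcpt lam) (toLie n K hcpt X)
          (@id (π.W ⊗[ℂ] ResGLnCohomology.CoeffModule ℂ n K lam) t) :=
  ⟨{ toFun := fun t => GKTensor.lie (AutomorphyDatum.gl n K hcpt).arch π.lieRepW (σ𝔤S hcpt lam) (toLie n K hcpt X) t
     map_add' := fun t t' => by rw [carrier_add_eq, map_add]; rfl
     map_smul' := fun r t => by rw [carrier_smul_eq, map_smul]; rfl }, fun _ => rfl⟩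

/-- **The `ℝ`-multilinear map `Y ↦ X · η(Y₀, …, Y_q)` of matrices, for a fixed matrix `X`**, with
values in the carrier `W ⊗ E_λ`. [cite: BorelWallach2000, I §5.1] -/
theorem cfg_exists_lieMultilinearAt (η : ConeDictionary.Cochain π lam (q + 1))
    (X : Matrix (Fin n) (Fin n) (mixedSpace K)) :
    ∃ T : MultilinearMap ℝ (fun _ : Fin (q + 1) => Matrix (Fin n) (Fin n) (mixedSpace K)) (Carrier π lam),
      ∀ Y : Fin (q + 1) → Matrix (Fin n) (Fin n) (mixedSpace K),
        @id (π.W ⊗[ℂ] ResGLnCohomology.CoeffModule ℂ n K lam) (T Y) =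
          GKTensor.lie (AutomorphyDatum.gl n K hcpt).arch π.lieRepW (σ𝔤S hcpt lam) (toLie n K hcpt X)
            (@id (π.W ⊗[ℂ] ResGLnCohomology.CoeffModule ℂ n K lam) (η fun i => toLie n K hcpt (Y i))) := by
  obtain ⟨ρX, hρX⟩ := cfg_exists_lieAction π lam (hcpt := hcpt) X
  refine ⟨ρX.compMultilinearMap (η.toMultilinearMap.compLinearMap fun _ : Fin (q + 1) => toLie n K hcpt),
    fun Y => ?_⟩
  rw [LinearMap.compMultilinearMap_apply, MultilinearMap.compLinearMap_apply, AlternatingMap.coe_multilinearMap, hρX]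

/-- **Order-1 growth of the left form** at the invertible matrices: the derivative along `g b_k`, on
vectors `Y`, is the twisted evaluation of `b_k · η(Y)` (`fderiv_leftForm_apply`), the twisted evaluation
of a multilinear map of `Y` for each matrix `b_k` of a basis; a general direction `Z` is
`∑_k c_k(g⁻¹ Z) · g b_k` with `|c_k(g⁻¹ Z)| ≤ C ‖g⁻¹‖ ‖Z‖`. [cite: BorelWallach2000, VII §2.2] -/
theorem cfg_norm_fderiv_leftFormN_growth (hsz : ∀ g, 1 ≤ sz g)
    (hE : ∀ (g : (AutomorphyDatum.gl n K hcpt).arch.carrier) i j,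
      ‖((g : GL (Fin n) (mixedSpace K)) : Matrix (Fin n) (Fin n) (mixedSpace K)) i j‖ ≤ sz g)
    (hI : ∀ (g : (AutomorphyDatum.gl n K hcpt).arch.carrier) i j, ‖(((g⁻¹ : (AutomorphyDatum.gl n K hcpt).arch.carrier) : GL (Fin n) (mixedSpace K)) :
      Matrix (Fin n) (Fin n) (mixedSpace K)) i j‖ ≤ sz g)
    (η : ConeDictionary.Cochain π lam (q + 1)) (c : BigHeckeGLn.FiniteAdelicGL n K) :
    ∃ (C : ℝ) (k : ℕ), 0 ≤ C ∧ ∀ g : (AutomorphyDatum.gl n K hcpt).arch.carrier,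
      ‖fderiv ℝ (leftFormN π S lam η c) ((g : GL (Fin n) (mixedSpace K)) : Matrix (Fin n) (Fin n) (mixedSpace K))‖ ≤
        C * sz g ^ k := by
  let b := Module.finBasis ℝ (Matrix (Fin n) (Fin n) (mixedSpace K))
  obtain ⟨Cb, hCb0, hCb⟩ := cfg_exists_coord_bound b
  -- per basis matrix `b_k`: the derivative along `g b_k` on vectors, and its growth
  have hk : ∀ k : Fin (Module.finrank ℝ (Matrix (Fin n) (Fin n) (mixedSpace K))), ∃ (C : ℝ) (e : ℕ), 0 ≤ C ∧
      ∀ (g : (AutomorphyDatum.gl n K hcpt).arch.carrier) (Y : Fin (q + 1) → Matrix (Fin n) (Fin n) (mixedSpace K)),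
        ‖fderiv ℝ (leftFormN π S lam η c) ((g : GL (Fin n) (mixedSpace K)) : Matrix (Fin n) (Fin n) (mixedSpace K))
          (((g : GL (Fin n) (mixedSpace K)) : Matrix (Fin n) (Fin n) (mixedSpace K)) * b k) Y‖ ≤
          C * sz g ^ e * ∏ i, ‖Y i‖ := by
    intro k
    obtain ⟨T, hT⟩ := cfg_exists_lieMultilinearAt π lam (hcpt := hcpt) η (b k)
    obtain ⟨C, e, hC, h⟩ := cfg_twistedEval_multilinear_growth π S lam sz hsz hE hI c T
    refine ⟨C, e, hC, fun g Y => ?_⟩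
    have hu : IsUnit ((g : GL (Fin n) (mixedSpace K)) : Matrix (Fin n) (Fin n) (mixedSpace K)) := Units.isUnit _
    have e3 : fderiv ℝ (leftFormN π S lam η c) ((g : GL (Fin n) (mixedSpace K)) : Matrix (Fin n) (Fin n) (mixedSpace K))
        (((g : GL (Fin n) (mixedSpace K)) : Matrix (Fin n) (Fin n) (mixedSpace K)) * b k) Y =
        twistedEval π S lam g c (T Y) := by
      rw [fderiv_leftForm_apply π S lam η c hu (b k) Y, archOfMatrix_coe_datum, twistedEval_apply, hT]
    rw [e3]
    exact h g Y
  choose C e hC0 hCe using hk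
  have hCsum0 : 0 ≤ ∑ k, C k := Finset.sum_nonneg fun k _ => hC0 k
  -- operator norm of each `D(g b_k)`, with uniform constants
  have hDk : ∀ k (g : (AutomorphyDatum.gl n K hcpt).arch.carrier),
      ‖fderiv ℝ (leftFormN π S lam η c) ((g : GL (Fin n) (mixedSpace K)) : Matrix (Fin n) (Fin n) (mixedSpace K))
        (((g : GL (Fin n) (mixedSpace K)) : Matrix (Fin n) (Fin n) (mixedSpace K)) * b k)‖ ≤
        (∑ k, C k) * sz g ^ (Finset.univ.sup e) := by
    intro k g
    have hsz0 : 0 ≤ sz g := zero_le_one.trans (hsz g)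
    refine ContinuousAlternatingMap.opNorm_le_bound _ (mul_nonneg hCsum0 (pow_nonneg hsz0 _)) fun Y => ?_
    refine (hCe k g Y).trans ?_
    have h1 : C k ≤ ∑ k, C k := Finset.single_le_sum (fun k _ => hC0 k) (Finset.mem_univ k)
    have h2 : sz g ^ e k ≤ sz g ^ Finset.univ.sup e :=
      pow_le_pow_right₀ (hsz g) (Finset.le_sup (f := e) (Finset.mem_univ k))
    exact mul_le_mul_of_nonneg_right (mul_le_mul h1 h2 (pow_nonneg hsz0 _) hCsum0)
      (Finset.prod_nonneg fun i _ => norm_nonneg _)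
  have hN0 : (0 : ℝ) ≤ (Fintype.card (Fin (Module.finrank ℝ (Matrix (Fin n) (Fin n) (mixedSpace K)))) : ℝ) :=
    Nat.cast_nonneg _
  have hn0 : (0 : ℝ) ≤ (n : ℝ) ^ 2 := by positivity
  refine ⟨(Fintype.card (Fin (Module.finrank ℝ (Matrix (Fin n) (Fin n) (mixedSpace K)))) : ℝ) * Cb *
      (n : ℝ) ^ 2 * ∑ k, C k, Finset.univ.sup e + 1,
    mul_nonneg (mul_nonneg (mul_nonneg hN0 hCb0) hn0) hCsum0, fun g => ?_⟩
  have hsz0 : 0 ≤ sz g := zero_le_one.trans (hsz g)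
  -- name the matrices of `g` and `g⁻¹` (opaque: no unfolding of inverses)
  obtain ⟨giM, hgiM⟩ : ∃ m : Matrix (Fin n) (Fin n) (mixedSpace K),
      m = (((g⁻¹ : (AutomorphyDatum.gl n K hcpt).arch.carrier) : GL (Fin n) (mixedSpace K)) :
        Matrix (Fin n) (Fin n) (mixedSpace K)) := ⟨_, rfl⟩
  obtain ⟨gM, hgM⟩ : ∃ m : Matrix (Fin n) (Fin n) (mixedSpace K),
      m = ((g : GL (Fin n) (mixedSpace K)) : Matrix (Fin n) (Fin n) (mixedSpace K)) := ⟨_, rfl⟩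
  have hgi : ‖giM‖ ≤ (n : ℝ) ^ 2 * sz g := by
    rw [hgiM]
    exact cfg_opNorm_le_of_entries _ (hI g)
  have hginv : gM * giM = 1 := by rw [hgM, hgiM, Subgroup.coe_inv, Units.mul_inv]
  have hDk' : ∀ k, ‖fderiv ℝ (leftFormN π S lam η c) gM (gM * b k)‖ ≤ (∑ k, C k) * sz g ^ Finset.univ.sup e := by
    intro k
    rw [hgM]
    exact hDk k g
  rw [← hgM]
  refine ContinuousLinearMap.opNorm_le_bound _ (by positivity) fun Z => ?_
  -- `Z = ∑_k c_k(g⁻¹ Z) · g b_k`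
  have hrepr : ∑ k, b.coord k (giM * Z) • b k = giM * Z := b.sum_repr _
  have hZ : Z = ∑ k, b.coord k (giM * Z) • (gM * b k) := by
    calc Z = gM * (giM * Z) := by rw [← mul_assoc, hginv, one_mul]
      _ = gM * ∑ k, b.coord k (giM * Z) • b k := by rw [hrepr]
      _ = _ := by rw [Finset.mul_sum]; exact Finset.sum_congr rfl fun k _ => Matrix.mul_smul _ _ _
  have hD : fderiv ℝ (leftFormN π S lam η c) gM Z =
      ∑ k, b.coord k (giM * Z) • fderiv ℝ (leftFormN π S lam η c) gM (gM * b k) :=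
    calc fderiv ℝ (leftFormN π S lam η c) gM Z
        = fderiv ℝ (leftFormN π S lam η c) gM (∑ k, b.coord k (giM * Z) • (gM * b k)) := congrArg _ hZ
      _ = ∑ k, fderiv ℝ (leftFormN π S lam η c) gM (b.coord k (giM * Z) • (gM * b k)) := map_sum _ _ _
      _ = _ := Finset.sum_congr rfl fun k _ => ContinuousLinearMap.map_smul _ _ _
  rw [hD]
  have hX : ‖giM * Z‖ ≤ (n : ℝ) ^ 2 * sz g * ‖Z‖ :=
    (norm_mul_le _ _).trans (mul_le_mul_of_nonneg_right hgi (norm_nonneg _))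
  have hDb0 : 0 ≤ (∑ k, C k) * sz g ^ Finset.univ.sup e := mul_nonneg hCsum0 (pow_nonneg hsz0 _)
  calc ‖∑ k, b.coord k (giM * Z) • fderiv ℝ (leftFormN π S lam η c) gM (gM * b k)‖
      ≤ ∑ k, ‖b.coord k (giM * Z)‖ * ‖fderiv ℝ (leftFormN π S lam η c) gM (gM * b k)‖ :=
        norm_sum_le_of_le _ fun k _ => by rw [_root_.norm_smul]
    _ ≤ ∑ _k : Fin (Module.finrank ℝ (Matrix (Fin n) (Fin n) (mixedSpace K))),
          (Cb * ‖giM * Z‖) * ((∑ k, C k) * sz g ^ Finset.univ.sup e) :=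
        Finset.sum_le_sum fun k _ => mul_le_mul (hCb _ _) (hDk' k) (norm_nonneg _) (mul_nonneg hCb0 (norm_nonneg _))
    _ = (Fintype.card (Fin (Module.finrank ℝ (Matrix (Fin n) (Fin n) (mixedSpace K)))) : ℝ) *
          ((Cb * ‖giM * Z‖) * ((∑ k, C k) * sz g ^ Finset.univ.sup e)) := by
        rw [Finset.sum_const, Finset.card_univ, nsmul_eq_mul]
    _ ≤ (Fintype.card (Fin (Module.finrank ℝ (Matrix (Fin n) (Fin n) (mixedSpace K)))) : ℝ) *
          ((Cb * ((n : ℝ) ^ 2 * sz g * ‖Z‖)) * ((∑ k, C k) * sz g ^ Finset.univ.sup e)) :=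
        mul_le_mul_of_nonneg_left (mul_le_mul_of_nonneg_right (mul_le_mul_of_nonneg_left hX hCb0) hDb0) hN0
    _ = (Fintype.card (Fin (Module.finrank ℝ (Matrix (Fin n) (Fin n) (mixedSpace K)))) : ℝ) * Cb *
          (n : ℝ) ^ 2 * (∑ k, C k) * sz g ^ (Finset.univ.sup e + 1) * ‖Z‖ := by
        rw [pow_succ]
        ring

end LeftForm

/-! ### 7. Smoothness of pull-backs; operator-norm book-keeping -/

section Smoothness

/-- **Pull-backs of `Cⁿ` families of alternating maps along `Cⁿ` families of linear maps are `Cⁿ`**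
(alternating maps on a finite-dimensional space with values in a finite-dimensional space): the
underlying multilinear map is `Cⁿ` (composition with linear maps is a continuous multilinear
operation, `ContinuousMultilinearMap.compContinuousLinearMapContinuousMultilinear`), and the
embedding of alternating into multilinear maps has a continuous linear left inverse. [folklore] -/
theorem cfg_contDiffAt_altCompCLM {X : Type*} [NormedAddCommGroup X] [NormedSpace ℝ X]
    {Kd : Type*} [NormedAddCommGroup Kd] [NormedSpace ℝ Kd] [FiniteDimensional ℝ Kd]
    {V : Type*} [NormedAddCommGroup V] [NormedSpace ℝ V]
    {F : Type*} [NormedAddCommGroup F] [NormedSpace ℝ F] [FiniteDimensional ℝ F]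
    {ι : Type*} [Fintype ι] {m : WithTop ℕ∞}
    {A : X → V [⋀^ι]→L[ℝ] F} {L : X → (Kd →L[ℝ] V)} {x : X}
    (hA : ContDiffAt ℝ m A x) (hL : ContDiffAt ℝ m L x) :
    ContDiffAt ℝ m (fun y => (A y).compContinuousLinearMap (L y)) x := by
  classical
  let Φ := ContinuousMultilinearMap.compContinuousLinearMapContinuousMultilinear ℝ
    (fun _ : ι => Kd) (fun _ : ι => V) F
  have h1 : ContDiffAt ℝ m (fun y => Φ (fun _ => L y) (A y).toContinuousMultilinearMap) x := by
    have hL' : ContDiffAt ℝ m (fun y => (fun _ : ι => L y)) x := contDiffAt_pi.2 fun _ => hL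
    have hA' : ContDiffAt ℝ m (fun y => (A y).toContinuousMultilinearMap) x :=
      ((ContinuousAlternatingMap.toContinuousMultilinearMapCLM ℝ :
        (V [⋀^ι]→L[ℝ] F) →L[ℝ] ContinuousMultilinearMap ℝ (fun _ : ι => V) F).contDiff).comp_contDiffAt x hA
    exact ((Φ.contDiff).comp_contDiffAt x hL').clm_apply hA'
  haveI : FiniteDimensional ℝ (ContinuousMultilinearMap ℝ (fun _ : ι => Kd) F) :=
    Module.Finite.of_injective
      (ContinuousMultilinearMap.toMultilinearMapLinear (R' := ℝ) :
        ContinuousMultilinearMap ℝ (fun _ : ι => Kd) F →ₗ[ℝ] MultilinearMap ℝ (fun _ : ι => Kd) F)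
      ContinuousMultilinearMap.toMultilinearMap_injective
  haveI : FiniteDimensional ℝ (Kd [⋀^ι]→L[ℝ] F) :=
    Module.Finite.of_injective
      ((ContinuousMultilinearMap.toMultilinearMapLinear (R' := ℝ)).comp
        (ContinuousAlternatingMap.toContinuousMultilinearMapLinear (R := ℝ)) :
          (Kd [⋀^ι]→L[ℝ] F) →ₗ[ℝ] MultilinearMap ℝ (fun _ : ι => Kd) F)
      (ContinuousMultilinearMap.toMultilinearMap_injective.comp
        ContinuousAlternatingMap.toContinuousMultilinearMap_injective)
  obtain ⟨P, hP⟩ : ∃ P : ContinuousMultilinearMap ℝ (fun _ : ι => Kd) F →L[ℝ] (Kd [⋀^ι]→L[ℝ] F),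
      ∀ θ : Kd [⋀^ι]→L[ℝ] F, P θ.toContinuousMultilinearMap = θ := by
    obtain ⟨g, hg⟩ := LinearMap.exists_leftInverse_of_injective
      ((ContinuousAlternatingMap.toContinuousMultilinearMapCLM ℝ :
        (Kd [⋀^ι]→L[ℝ] F) →L[ℝ] ContinuousMultilinearMap ℝ (fun _ : ι => Kd) F) :
        (Kd [⋀^ι]→L[ℝ] F) →ₗ[ℝ] ContinuousMultilinearMap ℝ (fun _ : ι => Kd) F)
      (LinearMap.ker_eq_bot.2 ContinuousAlternatingMap.toContinuousMultilinearMap_injective)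
    refine ⟨LinearMap.toContinuousLinearMap g, fun θ => ?_⟩
    exact congrArg (fun f : (Kd [⋀^ι]→L[ℝ] F) →ₗ[ℝ] (Kd [⋀^ι]→L[ℝ] F) => f θ) hg
  have heq : (fun y => (A y).compContinuousLinearMap (L y)) =
      fun y => P (Φ (fun _ => L y) (A y).toContinuousMultilinearMap) := by
    funext y
    rw [← hP ((A y).compContinuousLinearMap (L y))]
    congr 1
  rw [heq]
  exact P.contDiff.comp_contDiffAt x h1

/-- `‖f ∘' g‖ ≤ (q + 1) ‖g‖^q ‖f‖` for the derivative `f.fderivCompContinuousLinearMap g` of the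
pull-back in the linear map: on vectors it is the sum over the `q + 1` slots of `f` applied to
`(g v₀, …, dg vᵢ, …, g v_q)`. [folklore] -/
theorem cfg_norm_fderivCompCLM_le {E' F' G' : Type*} [NormedAddCommGroup E'] [NormedSpace ℝ E']
    [NormedAddCommGroup F'] [NormedSpace ℝ F'] [NormedAddCommGroup G'] [NormedSpace ℝ G'] {q : ℕ}
    (f : F' [⋀^Fin (q + 1)]→L[ℝ] G') (g : E' →L[ℝ] F') :
    ‖f.fderivCompContinuousLinearMap g‖ ≤ (q + 1) * ‖g‖ ^ q * ‖f‖ := by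
  refine ContinuousLinearMap.opNorm_le_bound _ (by positivity) fun dg => ?_
  refine ContinuousAlternatingMap.opNorm_le_bound _ (by positivity) fun v => ?_
  rw [ContinuousAlternatingMap.fderivCompContinuousLinearMap_apply]
  have hterm : ∀ i : Fin (q + 1), ‖f fun j => Function.update (fun _ => g) i dg j (v j)‖ ≤
      ‖f‖ * (‖dg‖ * ‖g‖ ^ q * ∏ j, ‖v j‖) := by
    intro i
    refine (f.le_opNorm _).trans (mul_le_mul_of_nonneg_left ?_ (norm_nonneg _))
    have hupd : ∀ j, ‖Function.update (fun _ : Fin (q + 1) => g) i dg j (v j)‖ ≤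
        Function.update (fun _ : Fin (q + 1) => ‖g‖) i ‖dg‖ j * ‖v j‖ := by
      intro j
      by_cases hj : j = i
      · subst hj
        rw [Function.update_self, Function.update_self]
        exact dg.le_opNorm _
      · rw [Function.update_of_ne hj, Function.update_of_ne hj]
        exact g.le_opNorm _
    calc ∏ j, ‖Function.update (fun _ : Fin (q + 1) => g) i dg j (v j)‖
        ≤ ∏ j, (Function.update (fun _ : Fin (q + 1) => ‖g‖) i ‖dg‖ j * ‖v j‖) :=
          Finset.prod_le_prod (fun j _ => norm_nonneg _) fun j _ => hupd j
      _ = (∏ j, Function.update (fun _ : Fin (q + 1) => ‖g‖) i ‖dg‖ j) * ∏ j, ‖v j‖ :=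
          Finset.prod_mul_distrib
      _ = ‖dg‖ * ‖g‖ ^ q * ∏ j, ‖v j‖ := by
          rw [Finset.prod_update_of_mem (Finset.mem_univ i), Finset.prod_const]
          congr 2
          rw [Finset.sdiff_singleton_eq_erase, Finset.card_erase_of_mem (Finset.mem_univ i),
            Finset.card_univ, Fintype.card_fin, Nat.add_sub_cancel]
  calc ‖∑ i, f fun j => Function.update (fun _ => g) i dg j (v j)‖
      ≤ ∑ i : Fin (q + 1), ‖f‖ * (‖dg‖ * ‖g‖ ^ q * ∏ j, ‖v j‖) := norm_sum_le_of_le _ fun i _ => hterm i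
    _ = (q + 1) * ‖g‖ ^ q * ‖f‖ * ‖dg‖ * ∏ j, ‖v j‖ := by
        rw [Finset.sum_const, Finset.card_univ, Fintype.card_fin, nsmul_eq_mul]
        push_cast
        ring

/-- If `x² ≤ P` and `P ≥ 1` then `x ≤ P` (for `x ≥ 0`). [folklore] -/
theorem cfg_le_of_sq_le {x P : ℝ} (hx : 0 ≤ x) (hP : 1 ≤ P) (h : x ^ 2 ≤ P) : x ≤ P := by
  rcases le_or_gt x 1 with h1 | h1
  · exact h1.trans hP
  · nlinarith

/-- A non-negative entry of a double family is bounded by `1 +` the double sum. [folklore] -/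
theorem cfg_le_one_add_sum {n : ℕ} {f : Fin n → Fin n → ℝ} (hf : ∀ i j, 0 ≤ f i j) (i j : Fin n) :
    f i j ≤ 1 + ∑ i, ∑ j, f i j := by
  have h1 : f i j ≤ ∑ j', f i j' := Finset.single_le_sum (f := fun j' => f i j') (fun j' _ => hf i j') (Finset.mem_univ j)
  have h2 : ∑ j', f i j' ≤ ∑ i', ∑ j', f i' j' :=
    Finset.single_le_sum (f := fun i' => ∑ j', f i' j') (fun i' _ => Finset.sum_nonneg fun j' _ => hf i' j')
      (Finset.mem_univ i)
  linarith

end Smoothness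

/-- **Registered sub-goal (part 3 of stub `stub_coneForm_growth`): order-0 and order-1 polynomial growth
of the left form `m ↦ (Y ↦ E(m) η(Y)(m, c))` at the invertible matrices** in any size `sz ≥ 1`
dominating the entries of `g, g⁻¹`. [cite: BorelWallach2000, VII 2.2–2.4] -/
theorem stub_coneGrowth_leftForm {n : ℕ} {K : Type} [Field K] [NumberField K]
    {hcpt : isCompact_glFiniteIntegralLevel n K} (π : AutomorphicRepData (AutomorphyDatum.gl n K hcpt))
    (S : Finset {w : InfinitePlace K // w.IsReal}) (lam : (K →+* ℂ) → Fin n → ℤ) {q : ℕ}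
    (sz : (AutomorphyDatum.gl n K hcpt).arch.carrier → ℝ) (hsz : ∀ g, 1 ≤ sz g)
    (hE : ∀ (g : (AutomorphyDatum.gl n K hcpt).arch.carrier) i j,
      ‖((g : GL (Fin n) (mixedSpace K)) : Matrix (Fin n) (Fin n) (mixedSpace K)) i j‖ ≤ sz g)
    (hI : ∀ (g : (AutomorphyDatum.gl n K hcpt).arch.carrier) i j, ‖(((g⁻¹ : (AutomorphyDatum.gl n K hcpt).arch.carrier) : GL (Fin n) (mixedSpace K)) :
      Matrix (Fin n) (Fin n) (mixedSpace K)) i j‖ ≤ sz g)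
    (η : ConeDictionary.Cochain π lam (q + 1)) (c : BigHeckeGLn.FiniteAdelicGL n K) :
    (∃ (C : ℝ) (k : ℕ), 0 ≤ C ∧ ∀ g : (AutomorphyDatum.gl n K hcpt).arch.carrier,
      ‖leftFormN π S lam η c ((g : GL (Fin n) (mixedSpace K)) : Matrix (Fin n) (Fin n) (mixedSpace K))‖ ≤
        C * sz g ^ k) ∧
    ∃ (C : ℝ) (k : ℕ), 0 ≤ C ∧ ∀ g : (AutomorphyDatum.gl n K hcpt).arch.carrier,
      ‖fderiv ℝ (leftFormN π S lam η c) ((g : GL (Fin n) (mixedSpace K)) : Matrix (Fin n) (Fin n) (mixedSpace K))‖ ≤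
        C * sz g ^ k :=
  ⟨cfg_norm_leftFormN_growth π S lam sz hsz hE hI η c, cfg_norm_fderiv_leftFormN_growth π S lam sz hsz hE hI η c⟩

end Summit.Langlands.Langlands.Theorems.HeckeEigenvalueField.Res

end
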